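import Mathlib
import HarnessLib
import Summits.AtomisticToContinuum.Crystallization.Theorems.PricedLinkCensusSoftFourRingsCapTypeAPrep
import Summits.AtomisticToContinuum.Crystallization.Theorems.PricedLinkCensusSoftFourRingsFacetSides

/-!
# Soft four-rings, endgame: the cells at a type-A vertex (`Cap` variant)

Endgame step (E1)/(E3) for `SoftFourRings` (route `PricedLinkCensus`): at a type-A vertex `v` (bonds
`w 0, …, w 3`, bonded link pairs `{w i, w j}`, `{w j, w k}`), `gamma_facet_common_neighbour` produces from
every facet through the `γ`-bond `{v, w l}` a wing index `t ∈ {i, k}`, a point `x ∉ N[v]` bonded to `w l`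
and `w t`, and the facet through `{v, w t}` other than the bond triangle.  Planarity input: every hull
edge lies in exactly two facets, `card_edgesOfFacet_filter_mem`, and `facet_kinds_of_no_slack`.
`Cap` variant (seat c3 of stmt-AtomisticToContinuum-14234) of `PricedLinkCensusSoftFourRingsTypeACell`:
the Tammes-13 hypothesis is replaced by the local covering property
`hT : ∀ p, ‖p‖ = 1 → ∃ x ∈ X, dist p x < 0.957`; hT-free lemmas are imported from the original.
-/

namespace Summit.AtomisticToContinuum.Crystallization.Theorems.Cap

open Real RealInnerProductSpace Literature.Geometry.DiscreteGeometry

section Setting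

open scoped Classical in
/-- **The cell lemma at a type-A vertex** (see the module docstring). -/
theorem gamma_facet_common_neighbour
    {X : Finset (EuclideanSpace ℝ (Fin 3))}
    {B : Finset (Finset (EuclideanSpace ℝ (Fin 3)))}
    (hT : ∀ p : EuclideanSpace ℝ (Fin 3), ‖p‖ = 1 → ∃ x ∈ X, dist p x < 0.957)
    (hX1 : ∀ y ∈ X, ‖y‖ = 1)
    (hcard : X.card = 12)
    (hsepX : ∀ u ∈ X, ∀ u' ∈ X, u ≠ u' → ⟪u, u'⟫ ≤ 1 - 1 / (2 * (101 / 100 : ℝ) ^ 2))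
    (hB : ∀ T ∈ B, ∃ u ∈ X, ∃ u' ∈ X, u ≠ u' ∧ 1 - (101 / 100 : ℝ) ^ 2 / 2 ≤ ⟪u, u'⟫ ∧ T = {u, u'})
    (hBcard : B.card = 24)
    (hdeg : ∀ v ∈ X, ∃ w : Fin 4 → EuclideanSpace ℝ (Fin 3), (∀ k, w k ∈ X) ∧ Function.Injective w ∧ (∀ k, w k ≠ v) ∧ (∀ k, ({v, w k} : Finset (EuclideanSpace ℝ (Fin 3))) ∈ B) ∧ ∀ y, ({v, y} : Finset (EuclideanSpace ℝ (Fin 3))) ∈ B → ∃ k, y = w k)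
    {v : EuclideanSpace ℝ (Fin 3)}
    (hv : v ∈ X)
    (w : Fin 4 → EuclideanSpace ℝ (Fin 3))
    (hwX : ∀ k, w k ∈ X)
    (hwinj : Function.Injective w)
    (hwv : ∀ k, w k ≠ v)
    (hvw : ∀ k, ({v, w k} : Finset (EuclideanSpace ℝ (Fin 3))) ∈ B)
    (hvonly : ∀ y, ({v, y} : Finset (EuclideanSpace ℝ (Fin 3))) ∈ B → ∃ k, y = w k)
    {i j k l : Fin 4}
    (hnd : [i, j, k, l].Nodup)
    (hBij : ({w i, w j} : Finset (EuclideanSpace ℝ (Fin 3))) ∈ B)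
    (hBjk : ({w j, w k} : Finset (EuclideanSpace ℝ (Fin 3))) ∈ B)
    (hNB : ∀ a b : Fin 4, a ≠ b → ({w a, w b} : Finset (EuclideanSpace ℝ (Fin 3))) ∈ B → ({a, b} : Finset (Fin 4)) = {i, j} ∨ ({a, b} : Finset (Fin 4)) = {j, k}) (c : EuclideanSpace ℝ (Fin 3)) (hcF : c ∈ facetNormals X)
    (hvc : v ∈ tightSet X c) (hlc : w l ∈ tightSet X c) :
    ∃ t : Fin 4, (t = i ∨ t = k) ∧ ∃ x ∈ X, x ≠ v ∧ (∀ s, x ≠ w s) ∧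
      ({x, w l} : Finset (EuclideanSpace ℝ (Fin 3))) ∈ B ∧ ({x, w t} : Finset (EuclideanSpace ℝ (Fin 3))) ∈ B ∧
      (∃ c₀ ∈ facetNormals X, x ∈ tightSet X c₀ ∧ w l ∈ tightSet X c₀ ∧
        ¬ ((tightSet X c₀).card = 3 ∧ ((edgesOfFacet X c₀).filter (fun T => T ∉ B)).card = 0)) ∧
      ∃ c' ∈ facetNormals X, v ∈ tightSet X c' ∧ w t ∈ tightSet X c' ∧ w j ∉ tightSet X c' ∧
        (c' = c ∨ (tightSet X c = {v, w l, x} ∧ tightSet X c' = {v, x, w t})) := by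
  obtain ⟨h0, hBH, -⟩ := hull_counts_of_twelve hT hX1 hcard hsepX hB hBcard
  have hnd' : (i ≠ j ∧ i ≠ k ∧ i ≠ l) ∧ (j ≠ k ∧ j ≠ l) ∧ k ≠ l := by
    simp only [List.nodup_cons, List.mem_cons, not_or, List.not_mem_nil,
      not_false_eq_true, and_true, List.nodup_nil] at hnd
    exact hnd
  have hγ : ∀ s, s ≠ l → ({w s, w l} : Finset (EuclideanSpace ℝ (Fin 3))) ∉ B := not_mem_bonds_gamma w hnd hNB
  have hγ' : ∀ {x : EuclideanSpace ℝ (Fin 3)}, ({x, w l} : Finset (EuclideanSpace ℝ (Fin 3))) ∈ B → ∀ s, x ≠ w s :=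
    fun hx => ne_link_of_bond_gamma hB w hnd hNB hx
  have hfour := fin_four_eq_of_nodup i j k l hnd
  have hik_of : ∀ t, t ≠ j → t ≠ l → t = i ∨ t = k := by
    intro t htj htl
    rcases hfour t with h | h | h | h
    · exact Or.inl h
    · exact absurd h htj
    · exact Or.inr h
    · exact absurd h htl
  have kinds := facet_kinds_of_no_slack hT hX1 hcard hsepX hB hBcard hdeg
  have hvl : v ≠ w l := (hwv l).symm
  have hnotj : ∀ c₀ ∈ facetNormals X, v ∈ tightSet X c₀ → w j ∈ tightSet X c₀ →
      (tightSet X c₀).card = 3 ∧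
      ∀ y ∈ tightSet X c₀, y = v ∨ y = w i ∨ y = w j ∨ y = w k := by
    intro c₀ hc₀ hv₀ hj₀
    rcases facet_through_alpha hT hX1 hcard hsepX hB hBcard hv w hwX hwinj hwv hvw hnd hBij hBjk
      c₀ hc₀ hv₀ hj₀ with h | h <;> rw [h]
    · refine ⟨?_, fun y hy => ?_⟩
      · rw [Finset.card_insert_of_notMem, Finset.card_pair (fun e => hnd'.1.1 (hwinj e))]
        simp only [Finset.mem_insert, Finset.mem_singleton, not_or]
        exact ⟨(hwv i).symm, (hwv j).symm⟩
      · simp only [Finset.mem_insert, Finset.mem_singleton] at hy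
        rcases hy with h | h | h
        exacts [Or.inl h, Or.inr (Or.inl h), Or.inr (Or.inr (Or.inl h))]
    · refine ⟨?_, fun y hy => ?_⟩
      · rw [Finset.card_insert_of_notMem, Finset.card_pair (fun e => hnd'.2.1.1 (hwinj e))]
        simp only [Finset.mem_insert, Finset.mem_singleton, not_or]
        exact ⟨(hwv j).symm, (hwv k).symm⟩
      · simp only [Finset.mem_insert, Finset.mem_singleton] at hy
        rcases hy with h | h | h
        exacts [Or.inl h, Or.inr (Or.inr (Or.inl h)), Or.inr (Or.inr (Or.inr h))]
  have hl_notj : ∀ c₀ ∈ facetNormals X, v ∈ tightSet X c₀ → w j ∈ tightSet X c₀ →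
      w l ∉ tightSet X c₀ := by
    intro c₀ hc₀ hv₀ hj₀ hl₀
    rcases (hnotj c₀ hc₀ hv₀ hj₀).2 (w l) hl₀ with h | h | h | h
    · exact hvl h.symm
    · exact hnd'.1.2.2 (hwinj h).symm
    · exact hnd'.2.1.2 (hwinj h).symm
    · exact hnd'.2.2 (hwinj h).symm
  rcases kinds c hcF with ⟨h3, hnb1⟩ | ⟨h4, hnb0⟩
  · ----------------------------------------------------------------- triangle `{v, w l, z}`
    obtain ⟨z, hzv, hzl, hTc⟩ := eq_three_of_two_mem h3 hvc hlc hvl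
    have hzc : z ∈ tightSet X c := by rw [hTc]; simp
    have hzX : z ∈ X := tightSet_subset X c hzc
    by_cases hvz : ({v, z} : Finset (EuclideanSpace ℝ (Fin 3))) ∈ B
    · --------------------------------------------- `z = w t` is a bond of `v`: apex triangle
      obtain ⟨t, rfl⟩ := hvonly z hvz
      have htl : t ≠ l := fun h => hzl (by rw [h])
      have hlt : ({w l, w t} : Finset (EuclideanSpace ℝ (Fin 3))) ∉ B := by
        rw [Finset.pair_comm]; exact hγ t htl
      have htj : t ≠ j := by
        intro htj'
        rw [htj'] at hzc
        exact hl_notj c hcF hvc hzc hlc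
      have htik := hik_of t htj htl
      have hside : ({w l, w t} : Finset (EuclideanSpace ℝ (Fin 3))) ∈ edgesOfFacet X c :=
        pair_mem_edgesOfFacet_of_card_three hX1 h0 hcF h3 hlc hzc hzl.symm
      have hH : ({w l, w t} : Finset (EuclideanSpace ℝ (Fin 3))) ∈ hullEdges X := by
        unfold edgesOfFacet at hside; exact (Finset.mem_filter.1 hside).1
      obtain ⟨c'', hc''F, hc''ne, hsub''⟩ := exists_facet_ne_of_mem_hullEdges hX1 h0 hH c
      have hl'' : w l ∈ tightSet X c'' := hsub'' (by simp)
      have ht'' : w t ∈ tightSet X c'' := hsub'' (by simp)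
      have hside'' : ({w l, w t} : Finset (EuclideanSpace ℝ (Fin 3))) ∈ edgesOfFacet X c'' :=
        pair_mem_edgesOfFacet hH hl'' ht''
      rcases kinds c'' hc''F with ⟨h3'', hnb1''⟩ | ⟨-, hnb0''⟩
      · have hnb'' : ((edgesOfFacet X c'').filter (fun T => T ∉ B)).card = 1 :=
          le_antisymm hnb1'' (one_le_nb_of_side hside'' hlt)
        obtain ⟨x, hxl, hxt, hTc''⟩ := eq_three_of_two_mem h3'' hl'' ht'' hzl.symm
        obtain ⟨hBlx, hBtx⟩ := mem_bonds_of_nb_one hX1 h0 hc''F hTc'' h3'' hnb'' hlt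
        have hxv : x ≠ v := by
          intro hxv
          apply hc''ne
          refine (mem_facetNormals.1 hc''F).eq_of_tightSet_eq ?_
          rw [hTc'', hTc, hxv]
          exact (tri_rotl v (w l) (w t)).symm
        have hxc'' : x ∈ tightSet X c'' := by rw [hTc'']; simp
        have hBxl : ({x, w l} : Finset (EuclideanSpace ℝ (Fin 3))) ∈ B := by rw [Finset.pair_comm]; exact hBlx
        refine ⟨t, htik, x, tightSet_subset X c'' hxc'', hxv, hγ' hBxl, hBxl,
          by rw [Finset.pair_comm]; exact hBtx, ⟨c'', hc''F, hxc'', hl'', fun h => by omega⟩,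
          c, hcF, hvc, hzc, ?_, Or.inl rfl⟩
        rw [hTc]
        simp only [Finset.mem_insert, Finset.mem_singleton, not_or]
        exact ⟨hwv j, fun h => hnd'.2.1.2 (hwinj h), fun h => htj (hwinj h).symm⟩
      · exact absurd (mem_bonds_of_nb_zero hnb0'' hside'') hlt
    · --------------------------------------------- `{v, z}` is the non-bond side of `c`
      have hside : ({v, z} : Finset (EuclideanSpace ℝ (Fin 3))) ∈ edgesOfFacet X c :=
        pair_mem_edgesOfFacet_of_card_three hX1 h0 hcF h3 hvc hzc hzv.symm
      have hnb : ((edgesOfFacet X c).filter (fun T => T ∉ B)).card = 1 :=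
        le_antisymm hnb1 (one_le_nb_of_side hside hvz)
      have hTc' : tightSet X c = {v, z, w l} := by rw [hTc, tri_swap23]
      obtain ⟨-, hBzl⟩ := mem_bonds_of_nb_one hX1 h0 hcF hTc' h3 hnb hvz
      have hzw : ∀ s, z ≠ w s := by
        intro s hs; subst hs; exact hvz (hvw s)
      have hH : ({v, z} : Finset (EuclideanSpace ℝ (Fin 3))) ∈ hullEdges X := by
        unfold edgesOfFacet at hside; exact (Finset.mem_filter.1 hside).1
      obtain ⟨c'', hc''F, hc''ne, hsub''⟩ := exists_facet_ne_of_mem_hullEdges hX1 h0 hH c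
      have hv'' : v ∈ tightSet X c'' := hsub'' (by simp)
      have hz'' : z ∈ tightSet X c'' := hsub'' (by simp)
      have hside'' : ({v, z} : Finset (EuclideanSpace ℝ (Fin 3))) ∈ edgesOfFacet X c'' :=
        pair_mem_edgesOfFacet hH hv'' hz''
      rcases kinds c'' hc''F with ⟨h3'', hnb1''⟩ | ⟨-, hnb0''⟩
      · have hnb'' : ((edgesOfFacet X c'').filter (fun T => T ∉ B)).card = 1 :=
          le_antisymm hnb1'' (one_le_nb_of_side hside'' hvz)
        obtain ⟨u, huv, huz, hTc''⟩ := eq_three_of_two_mem h3'' hv'' hz'' hzv.symm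
        obtain ⟨hBvu, hBzu⟩ := mem_bonds_of_nb_one hX1 h0 hc''F hTc'' h3'' hnb'' hvz
        obtain ⟨t, rfl⟩ := hvonly u hBvu
        have htl : t ≠ l := by
          intro htl
          apply hc''ne
          refine (mem_facetNormals.1 hc''F).eq_of_tightSet_eq ?_
          rw [hTc'', hTc, htl, tri_swap23]
        have ht'' : w t ∈ tightSet X c'' := by rw [hTc'']; simp
        have htj : t ≠ j := by
          intro htj
          rw [htj] at ht''
          rcases (hnotj c'' hc''F hv'' ht'').2 z hz'' with h | h | h | h
          · exact hzv h
          · exact hzw i h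
          · exact hzw j h
          · exact hzw k h
        have htik := hik_of t htj htl
        refine ⟨t, htik, z, hzX, hzv, hzw, hBzl, hBzu, ⟨c, hcF, hzc, hlc, fun h => by omega⟩,
          c'', hc''F, hv'', ht'', ?_, Or.inr ⟨hTc, hTc''⟩⟩
        rw [hTc'']
        simp only [Finset.mem_insert, Finset.mem_singleton, not_or]
        exact ⟨hwv j, fun h => hzw j h.symm, fun h => htj (hwinj h).symm⟩
      · exact absurd (mem_bonds_of_nb_zero hnb0'' hside'') hvz
  · ----------------------------------------------------------------- quadrilateral
    have hS₁ : ({v, w l} : Finset (EuclideanSpace ℝ (Fin 3))) ∈ edgesOfFacet X c :=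
      pair_mem_edgesOfFacet (hBH (hvw l)) hvc hlc
    have hfv := card_edgesOfFacet_filter_mem hX1 h0 hcF hvc
    have hS₁f : ({v, w l} : Finset (EuclideanSpace ℝ (Fin 3))) ∈ (edgesOfFacet X c).filter (fun T => v ∈ T) :=
      Finset.mem_filter.2 ⟨hS₁, by simp⟩
    obtain ⟨S₂, hS₂f, hS₂ne⟩ := Finset.exists_mem_ne (by rw [hfv]; norm_num) ({v, w l} : Finset _)
    obtain ⟨hS₂, hvS₂⟩ := Finset.mem_filter.1 hS₂f
    obtain ⟨y, hyc, hyv, rfl⟩ := side_eq_pair hS₂ hvS₂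
    obtain ⟨t, rfl⟩ := hvonly y (mem_bonds_of_nb_zero hnb0 hS₂)
    have htl : t ≠ l := fun h => hS₂ne (by rw [h])
    have htj : t ≠ j := by
      intro htj
      rw [htj] at hyc
      have := (hnotj c hcF hvc hyc).1
      omega
    have htik := hik_of t htj htl
    have hlt : w l ≠ w t := fun h => htl (hwinj h).symm
    obtain ⟨x, hxv, hxl, hxt, hTc⟩ := eq_four_of_three_mem h4 hvc hlc hyc hvl (hwv t).symm hlt
    have hxc : x ∈ tightSet X c := by rw [hTc]; simp
    have hfx := card_edgesOfFacet_filter_mem hX1 h0 hcF hxc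
    have hxside : ∀ S ∈ (edgesOfFacet X c).filter (fun T => x ∈ T),
        S = {x, w l} ∨ S = {x, w t} := by
      intro S hS
      obtain ⟨hSE, hxS⟩ := Finset.mem_filter.1 hS
      obtain ⟨y, hyc', hyx, rfl⟩ := side_eq_pair hSE hxS
      rw [hTc] at hyc'
      simp only [Finset.mem_insert, Finset.mem_singleton] at hyc'
      rcases hyc' with hy | hy | hy | hy
      · -- `{x, v}` would be a third side at `v`
        exfalso
        rw [hy] at hSE
        have h3v : ({({v, w l} : Finset (EuclideanSpace ℝ (Fin 3))), {v, w t}, {x, v}} : Finset (Finset (EuclideanSpace ℝ (Fin 3))))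
            ⊆ (edgesOfFacet X c).filter (fun T => v ∈ T) := by
          intro S hS
          simp only [Finset.mem_insert, Finset.mem_singleton] at hS
          rcases hS with rfl | rfl | rfl
          · exact hS₁f
          · exact hS₂f
          · exact Finset.mem_filter.2 ⟨hSE, by simp⟩
        have hcard3 : ({({v, w l} : Finset (EuclideanSpace ℝ (Fin 3))), {v, w t}, {x, v}} :
            Finset (Finset (EuclideanSpace ℝ (Fin 3)))).card = 3 := by
          refine Finset.card_eq_three.2 ⟨_, _, _, hS₂ne.symm, ?_, ?_, rfl⟩
          · intro h
            have : w l ∈ ({x, v} : Finset (EuclideanSpace ℝ (Fin 3))) := by rw [← h]; simp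
            simp only [Finset.mem_insert, Finset.mem_singleton] at this
            rcases this with h' | h'
            · exact hxl h'.symm
            · exact hvl h'.symm
          · intro h
            have : w t ∈ ({x, v} : Finset (EuclideanSpace ℝ (Fin 3))) := by rw [← h]; simp
            simp only [Finset.mem_insert, Finset.mem_singleton] at this
            rcases this with h' | h'
            · exact hxt h'.symm
            · exact (hwv t) h'
        have := Finset.card_le_card h3v
        rw [hcard3, hfv] at this
        omega
      · exact Or.inl (by rw [hy])
      · exact Or.inr (by rw [hy])
      · exact absurd hy hyx
    have hboth : ({x, w l} : Finset (EuclideanSpace ℝ (Fin 3))) ∈ edgesOfFacet X c ∧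
        ({x, w t} : Finset (EuclideanSpace ℝ (Fin 3))) ∈ edgesOfFacet X c := by
      obtain ⟨S, hS, S', hS', hSS'⟩ : ∃ S ∈ (edgesOfFacet X c).filter (fun T => x ∈ T),
          ∃ S' ∈ (edgesOfFacet X c).filter (fun T => x ∈ T), S ≠ S' := by
        obtain ⟨S, hS⟩ : ((edgesOfFacet X c).filter (fun T => x ∈ T)).Nonempty :=
          Finset.card_pos.1 (by rw [hfx]; norm_num)
        obtain ⟨S', hS', hne⟩ := Finset.exists_mem_ne (by rw [hfx]; norm_num) S
        exact ⟨S, hS, S', hS', hne.symm⟩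
      have hSE := (Finset.mem_filter.1 hS).1
      have hS'E := (Finset.mem_filter.1 hS').1
      rcases hxside S hS with rfl | rfl <;> rcases hxside S' hS' with rfl | rfl
      · exact absurd rfl hSS'
      · exact ⟨hSE, hS'E⟩
      · exact ⟨hS'E, hSE⟩
      · exact absurd rfl hSS'
    have hBxl : ({x, w l} : Finset (EuclideanSpace ℝ (Fin 3))) ∈ B := mem_bonds_of_nb_zero hnb0 hboth.1
    have hBxt : ({x, w t} : Finset (EuclideanSpace ℝ (Fin 3))) ∈ B := mem_bonds_of_nb_zero hnb0 hboth.2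
    refine ⟨t, htik, x, tightSet_subset X c hxc, hxv, hγ' hBxl, hBxl, hBxt,
      ⟨c, hcF, hxc, hlc, fun h => by omega⟩, c, hcF, hvc, hyc, ?_, Or.inl rfl⟩
    rw [hTc]
    simp only [Finset.mem_insert, Finset.mem_singleton, not_or]
    exact ⟨hwv j, fun h => hnd'.2.1.2 (hwinj h), fun h => htj (hwinj h).symm,
      fun h => hγ' hBxl j h.symm⟩

open scoped Classical in
/-- **Common neighbours at a type-A vertex**: the `γ`-partner `w l` has a common bond `x ∉ N[v]`
with each wing `w i`, `w k`. -/
theorem typeA_common_neighbours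
    {X : Finset (EuclideanSpace ℝ (Fin 3))}
    {B : Finset (Finset (EuclideanSpace ℝ (Fin 3)))}
    (hT : ∀ p : EuclideanSpace ℝ (Fin 3), ‖p‖ = 1 → ∃ x ∈ X, dist p x < 0.957)
    (hX1 : ∀ y ∈ X, ‖y‖ = 1)
    (hcard : X.card = 12)
    (hsepX : ∀ u ∈ X, ∀ u' ∈ X, u ≠ u' → ⟪u, u'⟫ ≤ 1 - 1 / (2 * (101 / 100 : ℝ) ^ 2))
    (hB : ∀ T ∈ B, ∃ u ∈ X, ∃ u' ∈ X, u ≠ u' ∧ 1 - (101 / 100 : ℝ) ^ 2 / 2 ≤ ⟪u, u'⟫ ∧ T = {u, u'})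
    (hBcard : B.card = 24)
    (hdeg : ∀ v ∈ X, ∃ w : Fin 4 → EuclideanSpace ℝ (Fin 3), (∀ k, w k ∈ X) ∧ Function.Injective w ∧ (∀ k, w k ≠ v) ∧ (∀ k, ({v, w k} : Finset (EuclideanSpace ℝ (Fin 3))) ∈ B) ∧ ∀ y, ({v, y} : Finset (EuclideanSpace ℝ (Fin 3))) ∈ B → ∃ k, y = w k)
    {v : EuclideanSpace ℝ (Fin 3)}
    (hv : v ∈ X)
    (w : Fin 4 → EuclideanSpace ℝ (Fin 3))
    (hwX : ∀ k, w k ∈ X)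
    (hwinj : Function.Injective w)
    (hwv : ∀ k, w k ≠ v)
    (hvw : ∀ k, ({v, w k} : Finset (EuclideanSpace ℝ (Fin 3))) ∈ B)
    (hvonly : ∀ y, ({v, y} : Finset (EuclideanSpace ℝ (Fin 3))) ∈ B → ∃ k, y = w k)
    {i j k l : Fin 4}
    (hnd : [i, j, k, l].Nodup)
    (hBij : ({w i, w j} : Finset (EuclideanSpace ℝ (Fin 3))) ∈ B)
    (hBjk : ({w j, w k} : Finset (EuclideanSpace ℝ (Fin 3))) ∈ B)
    (hNB : ∀ a b : Fin 4, a ≠ b → ({w a, w b} : Finset (EuclideanSpace ℝ (Fin 3))) ∈ B → ({a, b} : Finset (Fin 4)) = {i, j} ∨ ({a, b} : Finset (Fin 4)) = {j, k}) :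
    (∃ x ∈ X, x ≠ v ∧ (∀ s, x ≠ w s) ∧ ({x, w l} : Finset (EuclideanSpace ℝ (Fin 3))) ∈ B ∧
      ({x, w i} : Finset (EuclideanSpace ℝ (Fin 3))) ∈ B ∧
      ∃ c₀ ∈ facetNormals X, x ∈ tightSet X c₀ ∧ w l ∈ tightSet X c₀ ∧
        ¬ ((tightSet X c₀).card = 3 ∧ ((edgesOfFacet X c₀).filter (fun T => T ∉ B)).card = 0)) ∧
    (∃ x ∈ X, x ≠ v ∧ (∀ s, x ≠ w s) ∧ ({x, w l} : Finset (EuclideanSpace ℝ (Fin 3))) ∈ B ∧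
      ({x, w k} : Finset (EuclideanSpace ℝ (Fin 3))) ∈ B ∧
      ∃ c₀ ∈ facetNormals X, x ∈ tightSet X c₀ ∧ w l ∈ tightSet X c₀ ∧
        ¬ ((tightSet X c₀).card = 3 ∧ ((edgesOfFacet X c₀).filter (fun T => T ∉ B)).card = 0)) := by
  obtain ⟨h0, hBH, -⟩ := hull_counts_of_twelve hT hX1 hcard hsepX hB hBcard
  have hnd' : (i ≠ j ∧ i ≠ k ∧ i ≠ l) ∧ (j ≠ k ∧ j ≠ l) ∧ k ≠ l := by
    simp only [List.nodup_cons, List.mem_cons, not_or, List.not_mem_nil,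
      not_false_eq_true, and_true, List.nodup_nil] at hnd
    exact hnd
  have hH : ({v, w l} : Finset (EuclideanSpace ℝ (Fin 3))) ∈ hullEdges X := hBH (hvw l)
  obtain ⟨c₁, hc₁F, hsub₁⟩ := exists_facet_of_mem_hullEdges h0 hH
  obtain ⟨c₂, hc₂F, hc₂₁, hsub₂⟩ := exists_facet_ne_of_mem_hullEdges hX1 h0 hH c₁
  have hv₁ : v ∈ tightSet X c₁ := hsub₁ (by simp)
  have hl₁ : w l ∈ tightSet X c₁ := hsub₁ (by simp)
  have hv₂ : v ∈ tightSet X c₂ := hsub₂ (by simp)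
  have hl₂ : w l ∈ tightSet X c₂ := hsub₂ (by simp)
  obtain ⟨t₁, ht₁, x₁, hx₁X, hx₁v, hx₁w, hB₁l, hB₁t, hf₁, c₁', hc₁'F, hv₁', ht₁', hj₁', tag₁⟩ :=
    gamma_facet_common_neighbour hT hX1 hcard hsepX hB hBcard hdeg hv w hwX hwinj hwv hvw hvonly
      hnd hBij hBjk hNB c₁ hc₁F hv₁ hl₁
  obtain ⟨t₂, ht₂, x₂, hx₂X, hx₂v, hx₂w, hB₂l, hB₂t, hf₂, c₂', hc₂'F, hv₂', ht₂', hj₂', tag₂⟩ :=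
    gamma_facet_common_neighbour hT hX1 hcard hsepX hB hBcard hdeg hv w hwX hwinj hwv hvw hvonly
      hnd hBij hBjk hNB c₂ hc₂F hv₂ hl₂
  have ht₁₂ : t₁ ≠ t₂ := by
    intro heq
    rw [← heq] at hB₂t ht₂' tag₂
    have htl : t₁ ≠ l := by
      rcases ht₁ with rfl | rfl
      · exact hnd'.1.2.2
      · exact hnd'.2.2
    obtain ⟨b, hbF, hbv, hbt, hbj⟩ : ∃ b ∈ facetNormals X, v ∈ tightSet X b ∧
        w t₁ ∈ tightSet X b ∧ w j ∈ tightSet X b := by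
      rcases ht₁ with rfl | rfl
      · obtain ⟨b, hbF, hbT, -⟩ :=
          bondTriangle_at_of_mem_bonds hX1 hsepX hB hv w hwX hwinj hwv hvw hnd'.1.1 hBij
        exact ⟨b, hbF, by rw [hbT]; simp, by rw [hbT]; simp, by rw [hbT]; simp⟩
      · obtain ⟨b, hbF, hbT, -⟩ :=
          bondTriangle_at_of_mem_bonds hX1 hsepX hB hv w hwX hwinj hwv hvw hnd'.2.1.1 hBjk
        exact ⟨b, hbF, by rw [hbT]; simp, by rw [hbT]; simp, by rw [hbT]; simp⟩
    have hsub : ∀ c', v ∈ tightSet X c' → w t₁ ∈ tightSet X c' →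
        ({v, w t₁} : Finset (EuclideanSpace ℝ (Fin 3))) ⊆ tightSet X c' := by
      intro c' h1 h2 y hy
      rw [Finset.mem_insert, Finset.mem_singleton] at hy
      rcases hy with rfl | rfl <;> assumption
    have hc' : c₁' = c₂' := by
      by_contra hne
      have hb1 : b ≠ c₁' := fun h => hj₁' (h ▸ hbj)
      have hb2 : b ≠ c₂' := fun h => hj₂' (h ▸ hbj)
      exact false_of_three_facetsOfEdge hX1 h0 (hBH (hvw t₁)) hbF hc₁'F hc₂'F (hsub b hbv hbt)
        (hsub c₁' hv₁' ht₁') (hsub c₂' hv₂' ht₂') hb1 hb2 hne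
    have hwl_not : ∀ x : EuclideanSpace ℝ (Fin 3), (∀ s, x ≠ w s) →
        w l ∉ ({v, x, w t₁} : Finset (EuclideanSpace ℝ (Fin 3))) := by
      intro x hxw h
      simp only [Finset.mem_insert, Finset.mem_singleton] at h
      rcases h with h | h | h
      · exact (hwv l) h
      · exact hxw l h.symm
      · exact htl (hwinj h).symm
    rcases tag₁ with e₁ | ⟨hT₁, hT₁'⟩ <;> rcases tag₂ with e₂ | ⟨hT₂, hT₂'⟩
    · exact hc₂₁ (by rw [← e₂, ← hc', e₁])
    · -- `c₁ = c₁' = c₂'` has tight set `{v, x₂, w t₁}` but contains `w l`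
      have : w l ∈ tightSet X c₂' := by rw [← hc', e₁]; exact hl₁
      rw [hT₂'] at this
      exact hwl_not x₂ hx₂w this
    · have : w l ∈ tightSet X c₁' := by rw [hc', e₂]; exact hl₂
      rw [hT₁'] at this
      exact hwl_not x₁ hx₁w this
    · -- `x₁ = x₂`, then `c₁ = c₂`
      have hx : x₁ ∈ ({v, x₂, w t₁} : Finset (EuclideanSpace ℝ (Fin 3))) := by
        rw [← hT₂', ← hc', hT₁']; simp
      simp only [Finset.mem_insert, Finset.mem_singleton] at hx
      rcases hx with h | h | h
      · exact hx₁v h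
      · apply hc₂₁
        refine (mem_facetNormals.1 hc₂F).eq_of_tightSet_eq ?_
        rw [hT₂, hT₁, h]
      · exact hx₁w t₁ h
  rcases ht₁ with rfl | rfl <;> rcases ht₂ with rfl | rfl
  · exact absurd rfl ht₁₂
  · exact ⟨⟨x₁, hx₁X, hx₁v, hx₁w, hB₁l, hB₁t, hf₁⟩, ⟨x₂, hx₂X, hx₂v, hx₂w, hB₂l, hB₂t, hf₂⟩⟩
  · exact ⟨⟨x₂, hx₂X, hx₂v, hx₂w, hB₂l, hB₂t, hf₂⟩, ⟨x₁, hx₁X, hx₁v, hx₁w, hB₁l, hB₁t, hf₁⟩⟩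
  · exact absurd rfl ht₁₂

end Setting

end Summit.AtomisticToContinuum.Crystallization.Theorems.Cap
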